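import Mathlib

/-!
# `SnSubsetDichotomy.ThresholdSubsetTriples`, line `SketchIdeator2` — stub `stub_twistFree_of_blocked`

Pure-logic step (crux `stmt-MatrixMultiplication-10882`, registered stub
`stub_twistFree_of_blocked` of the lead's skeleton for line `SketchIdeator2`).

If every twisted corner `x₁x₁'⁻¹ τ x₂x₂'⁻¹ τ x₃x₃'⁻¹ τ = 1` of a host `K ⊆ S_n` is either
trivial or has a non-trivial quotient `xᵢxᵢ'⁻¹` in a blocking set `B`, and a sub-code `X ⊆ K`
avoids `B` as a quotient (`x x'⁻¹ ∈ B ⇒ x = x'`), then every twisted corner of `X` is trivial: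
each blocked alternative `xᵢxᵢ'⁻¹ ∈ B ∧ xᵢ ≠ xᵢ'` contradicts avoidance at `xᵢ, xᵢ' ∈ X`.
-/

namespace Summit.MatrixMultiplication.MatrixMultiplication.Theorems.ThresholdSubsetTriples

/-- **Stub `stub_twistFree_of_blocked` — blocked host ⇒ twisted-corner-free sub-code** (line
`SketchIdeator2` of crux `SnSubsetDichotomy.ThresholdSubsetTriples`,
stmt-MatrixMultiplication-10882).  If every twisted corner
`x₁x₁'⁻¹ τ x₂x₂'⁻¹ τ x₃x₃'⁻¹ τ = 1` of `K` is trivial or has a non-trivial quotient `xᵢxᵢ'⁻¹`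
in `B`, and `X ⊆ K` avoids `B` as a quotient, then `X` has only trivial twisted corners:
a blocked alternative `xᵢxᵢ'⁻¹ ∈ B ∧ xᵢ ≠ xᵢ'` contradicts avoidance at `xᵢ, xᵢ' ∈ X`.
Pure logic. [folklore] -/
theorem stub_twistFree_of_blocked : ∀ (n : ℕ) (τ : Equiv.Perm (Fin n)) (K B X : Finset (Equiv.Perm (Fin n))), X ⊆ K → (∀ x₁ ∈ K, ∀ x₁' ∈ K, ∀ x₂ ∈ K, ∀ x₂' ∈ K, ∀ x₃ ∈ K, ∀ x₃' ∈ K, x₁ * x₁'⁻¹ * τ * (x₂ * x₂'⁻¹) * τ * (x₃ * x₃'⁻¹) * τ = 1 → (x₁ = x₁' ∧ x₂ = x₂' ∧ x₃ = x₃') ∨ (x₁ * x₁'⁻¹ ∈ B ∧ x₁ ≠ x₁') ∨ (x₂ * x₂'⁻¹ ∈ B ∧ x₂ ≠ x₂') ∨ (x₃ * x₃'⁻¹ ∈ B ∧ x₃ ≠ x₃')) → (∀ x ∈ X, ∀ x' ∈ X, x * x'⁻¹ ∈ B → x = x') → ∀ x₁ ∈ X, ∀ x₁' ∈ X, ∀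 x₂ ∈ X, ∀ x₂' ∈ X, ∀ x₃ ∈ X, ∀ x₃' ∈ X, x₁ * x₁'⁻¹ * τ * (x₂ * x₂'⁻¹) * τ * (x₃ * x₃'⁻¹) * τ = 1 → x₁ = x₁' ∧ x₂ = x₂' ∧ x₃ = x₃' := by
  intro n τ K B X hXK hK hA x₁ h₁ x₁' h₁' x₂ h₂ x₂' h₂' x₃ h₃ x₃' h₃' heq
  rcases hK x₁ (hXK h₁) x₁' (hXK h₁') x₂ (hXK h₂) x₂' (hXK h₂') x₃ (hXK h₃) x₃' (hXK h₃') heq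
    with h | ⟨hb, hne⟩ | ⟨hb, hne⟩ | ⟨hb, hne⟩
  · exact h
  · exact absurd (hA x₁ h₁ x₁' h₁' hb) hne
  · exact absurd (hA x₂ h₂ x₂' h₂' hb) hne
  · exact absurd (hA x₃ h₃ x₃' h₃' hb) hne

end Summit.MatrixMultiplication.MatrixMultiplication.Theorems.ThresholdSubsetTriples
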